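import Mathlib.GroupTheory.PushoutI
import Mathlib.GroupTheory.ResiduallyFinite
import Mathlib.Algebra.Order.BigOperators.GroupWithZero.Finset
import Mathlib.Algebra.BigOperators.Group.Finset.Piecewise
import Mathlib.Data.Fintype.BigOperators
import Literature.GroupTheory.PermutationGroups.FreeActionExtension
import HarnessLib

/-!
# Amalgamated free products of finite groups are residually finite

Topic `Literature/GroupTheory/CombinatorialGroupTheory`; theorems only.  For a finite family of
FINITE groups `G i` and a finite group `H` with INJECTIVE homomorphisms `φ i : H →* G i`, the
amalgamated free product `Γ = ∗_H G i` (Mathlib's `Monoid.PushoutI φ`) is residually finite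
(`pushoutI_residuallyFinite`).

This is the classical fact that "free products of finitely many finite groups with an amalgamated
subgroup are residually finite" (D. E. Cohen, *Combinatorial Group Theory: a topological
approach*, LMS Student Texts 14 (1989), Ch. 1: Prop. 22 for free products, Prop. 33 for HNN
extensions of finite groups, Exercise 27 for amalgams; G. Baumslag, Trans. AMS 106 (1963) 193–209,
§2).  It is the finite-level input of Baumslag's theorem that cyclic amalgams of free groups are
residually finite, hence of the residual finiteness of surface groups.

## Proof (finite completion of the truncated regular action; no normal form is used beyond
Mathlib's `Monoid.PushoutI.of_injective` / `base_injective`)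

* `exists_perm_hom_of_base_stable` (**finite completion**): let `T ⊆ Γ` be finite and stable
  under the base group `H`.  Put `Ω = T × Fin m`, `m = ∏ |G i|`.  For each `i`, `G i` acts
  honestly by left multiplication (a FREE action, `of i` being injective) on the part of `Ω` over
  `D_i = {x ∈ T | (of i g) x ∈ T for all g}`; `H` acts honestly and freely on all of `Ω`; the
  complement of `D_i × Fin m` is `H`-stable of cardinality divisible by `|G i|`, so there the free
  `H`-action extends to SOME `G i`-action
  (`Literature.GroupTheory.PermutationGroups.exists_perm_hom_comp_eq_of_free`).  The resulting
  actions agree on `H` and glue to `F : Γ →* Perm Ω`, honest over each `D_i`.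
* `pushoutI_residuallyFinite`: for `γ ≠ 1` written as a product of letters `t₁ ⋯ tₙ`,
  `t_j = of i_j g_j`, take `T` = all `of i g · (t_j ⋯ tₙ)`; every suffix product lies in every
  `D_i`, so `F γ` moves `(1, 0)` to `(γ, 0) ≠ (1, 0)`.

## References

* D. E. Cohen, *Combinatorial Group Theory: a topological approach*, LMS Student Texts 14,
  Cambridge Univ. Press (1989), Ch. 1, Props. 22, 33, Exercise 27. [CohenCGT1989]
* G. Baumslag, *On the residual finiteness of generalised free products of nilpotent groups*,
  Trans. Amer. Math. Soc. 106 (1963) 193–209. [Baumslag1963]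
-/

namespace Literature.GroupTheory.CombinatorialGroupTheory

open Monoid Monoid.PushoutI Function Equiv

universe u v w

variable {ι : Type u} {G : ι → Type v} [∀ i, Group (G i)] {H : Type w} [Group H]
  {φ : ∀ i, H →* G i}

/-- Every element of the amalgam is the product of a list of letters `of i g`.
[cite: CohenCGT1989, Ch. 1 Prop. 22] -/
theorem exists_list_prod_eq [Nonempty ι] (γ : PushoutI φ) :
    ∃ L : List (Σ i, G i), γ = (L.map fun x => of (φ := φ) x.1 x.2).prod := by
  refine PushoutI.induction_on (motive := fun γ => ∃ L : List (Σ i, G i),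
      γ = (L.map fun x => of (φ := φ) x.1 x.2).prod) γ (fun i g => ⟨[⟨i, g⟩], by simp⟩)
    (fun h => ?_) (fun x y hx hy => ?_)
  · obtain ⟨i⟩ := ‹Nonempty ι›
    exact ⟨[⟨i, φ i h⟩], by simp [of_apply_eq_base]⟩
  · obtain ⟨L₁, rfl⟩ := hx
    obtain ⟨L₂, rfl⟩ := hy
    exact ⟨L₁ ++ L₂, by simp⟩

/-- If the index type is empty, the amalgam is the base group: `base` is surjective.
[cite: CohenCGT1989, Ch. 1 Prop. 22] -/
theorem base_surjective_of_isEmpty [IsEmpty ι] : Function.Surjective (base φ) := fun γ =>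
  PushoutI.induction_on (motive := fun γ => ∃ a, base φ a = γ) γ (fun i _ => (IsEmpty.false i).elim)
    (fun h => ⟨h, rfl⟩) fun x y hx hy => by
    obtain ⟨a, rfl⟩ := hx
    obtain ⟨b, rfl⟩ := hy
    exact ⟨a * b, map_mul _ _ _⟩

/-- **One factor of the finite completion.**  Let `T ⊆ Γ` be finite, `Ω = T × Fin m` with
`|G i| ∣ m`, and `θ : H →* Perm Ω` the honest action of the base group (`θ h (x, r) = (h·x, r)`).
Then there is an action `ρ : G i →* Perm Ω` with `ρ ∘ φ i = θ` which is honest left multiplication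
at every point `(x, r)` all of whose `G i`-translates `(of i g) x` stay in `T`.
[cite: CohenCGT1989, Ch. 1 proof of Prop. 33] -/
theorem exists_perm_hom_factor (i : ι) [Finite (G i)] (hφ : ∀ j, Injective (φ j))
    {T : Set (PushoutI φ)} [Finite T] {m : ℕ} (hdvd : Nat.card (G i) ∣ m)
    (θ : H →* Perm (T × Fin m))
    (hθ : ∀ (h : H) (ω : T × Fin m),
      ((θ h ω).1 : PushoutI φ) = base φ h * (ω.1 : PushoutI φ) ∧ (θ h ω).2 = ω.2) :
    ∃ ρ : G i →* Perm (T × Fin m), ρ.comp (φ i) = θ ∧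
      ∀ (g : G i) (ω : T × Fin m), (∀ g' : G i, of i g' * (ω.1 : PushoutI φ) ∈ T) →
        ((ρ g ω).1 : PushoutI φ) = of i g * (ω.1 : PushoutI φ) ∧ (ρ g ω).2 = ω.2 := by
  classical
  -- the honest domain (as a predicate on `Ω`)
  obtain ⟨pD, hpD⟩ : ∃ pD : T × Fin m → Prop,
      ∀ ω, pD ω ↔ ∀ g' : G i, of i g' * (ω.1 : PushoutI φ) ∈ T := ⟨_, fun _ => Iff.rfl⟩
  have hpD_of : ∀ {ω : T × Fin m} (hω : pD ω) (g : G i),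
      of i g * (ω.1 : PushoutI φ) ∈ T ∧
        ∀ g' : G i, of i g' * (of i g * (ω.1 : PushoutI φ)) ∈ T := by
    intro ω hω g
    refine ⟨(hpD ω).mp hω g, fun g' => ?_⟩
    rw [← mul_assoc, ← map_mul]
    exact (hpD ω).mp hω _
  -- honest action on `{ω // pD ω}`
  let actD : G i → {ω // pD ω} → {ω // pD ω} := fun g ω =>
    ⟨(⟨of i g * (ω.1.1 : PushoutI φ), (hpD_of ω.2 g).1⟩, ω.1.2),
      (hpD _).mpr (hpD_of ω.2 g).2⟩
  have hactD : ∀ (g : G i) (ω : {ω // pD ω}),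
      ((actD g ω).1.1 : PushoutI φ) = of i g * (ω.1.1 : PushoutI φ) ∧ (actD g ω).1.2 = ω.1.2 :=
    fun _ _ => ⟨rfl, rfl⟩
  have actD_mul : ∀ (g g' : G i) (ω : {ω // pD ω}), actD (g * g') ω = actD g (actD g' ω) := by
    intro g g' ω
    refine Subtype.ext (Prod.ext (Subtype.ext ?_) ?_)
    · rw [(hactD (g * g') ω).1, (hactD g (actD g' ω)).1, (hactD g' ω).1, map_mul, mul_assoc]
    · rw [(hactD (g * g') ω).2, (hactD g (actD g' ω)).2, (hactD g' ω).2]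
  have actD_one : ∀ ω : {ω // pD ω}, actD 1 ω = ω := by
    intro ω
    refine Subtype.ext (Prod.ext (Subtype.ext ?_) ?_)
    · rw [(hactD 1 ω).1, map_one, one_mul]
    · rw [(hactD 1 ω).2]
  let ρD : G i →* Perm {ω // pD ω} :=
    { toFun := fun g =>
        { toFun := actD g
          invFun := actD g⁻¹
          left_inv := fun ω => by rw [← actD_mul, inv_mul_cancel, actD_one]
          right_inv := fun ω => by rw [← actD_mul, mul_inv_cancel, actD_one] }
      map_one' := by ext ω : 1; exact actD_one ω
      map_mul' := fun g g' => by ext ω : 1; exact actD_mul g g' ω }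
  have hρD : ∀ (g : G i) (ω : {ω // pD ω}), ρD g ω = actD g ω := fun _ _ => rfl
  -- the complement is `θ`-stable; `θ` restricts to a free action `κ` there
  have hstable : ∀ (h : H) (ω : T × Fin m), pD (θ h ω) ↔ pD ω := by
    intro h ω
    rw [hpD, hpD, (hθ h ω).1]
    constructor
    · intro hx g
      have := hx (g * (φ i h)⁻¹)
      rwa [map_mul, map_inv, of_apply_eq_base, mul_assoc, inv_mul_cancel_left] at this
    · intro hx g
      rw [← of_apply_eq_base φ i, ← mul_assoc, ← map_mul]
      exact hx _
  let actU : H → {ω // ¬pD ω} → {ω // ¬pD ω} := fun h ω =>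
    ⟨θ h ω.1, fun hc => ω.2 ((hstable h ω.1).mp hc)⟩
  have hactU : ∀ (h : H) (ω : {ω // ¬pD ω}), ((actU h ω) : T × Fin m) = θ h ω.1 := fun _ _ => rfl
  have actU_mul : ∀ (h h' : H) (ω : {ω // ¬pD ω}), actU (h * h') ω = actU h (actU h' ω) := by
    intro h h' ω
    refine Subtype.ext ?_
    rw [hactU, hactU, hactU, map_mul, Perm.mul_apply]
  have actU_one : ∀ ω : {ω // ¬pD ω}, actU 1 ω = ω := by
    intro ω
    refine Subtype.ext ?_
    rw [hactU, map_one, Perm.one_apply]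
  let κ : H →* Perm {ω // ¬pD ω} :=
    { toFun := fun h =>
        { toFun := actU h
          invFun := actU h⁻¹
          left_inv := fun ω => by rw [← actU_mul, inv_mul_cancel, actU_one]
          right_inv := fun ω => by rw [← actU_mul, mul_inv_cancel, actU_one] }
      map_one' := by ext ω : 1; exact actU_one ω
      map_mul' := fun h h' => by ext ω : 1; exact actU_mul h h' ω }
  have hκ : ∀ (h : H) (ω : {ω // ¬pD ω}), ((κ h ω) : T × Fin m) = θ h ω.1 := fun _ _ => rfl
  have hκfree : ∀ h : H, h ≠ 1 → ∀ ω : {ω // ¬pD ω}, κ h ω ≠ ω := by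
    intro h hh ω hω
    apply hh
    have h1 : ((θ h ω.1).1 : PushoutI φ) = (ω.1.1 : PushoutI φ) := by
      rw [← hκ h ω, hω]
    rw [(hθ h ω.1).1] at h1
    have h2 : base φ h = 1 := mul_eq_right.mp h1
    exact base_injective hφ (by rw [h2, map_one])
  -- cardinality of the complement is divisible by `|G i|`
  have hcardU : Nat.card (G i) ∣ Nat.card {ω // ¬pD ω} := by
    let e : {ω : T × Fin m // ¬pD ω} ≃
        {x : T // ¬ ∀ g' : G i, of i g' * (x : PushoutI φ) ∈ T} × Fin m :=
      { toFun := fun ω => (⟨ω.1.1, fun hc => ω.2 ((hpD ω.1).mpr hc)⟩, ω.1.2)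
        invFun := fun p => ⟨(p.1.1, p.2), fun hc => p.1.2 ((hpD _).mp hc)⟩
        left_inv := fun ω => rfl
        right_inv := fun p => rfl }
    rw [Nat.card_congr e, Nat.card_prod, Nat.card_eq_fintype_card (α := Fin m), Fintype.card_fin]
    exact Dvd.dvd.mul_left hdvd _
  obtain ⟨ρU, hρU, -⟩ :=
    Literature.GroupTheory.PermutationGroups.exists_perm_hom_comp_eq_of_free (φ i) (hφ i) κ
      hκfree hcardU
  have hρU' : ∀ (h : H) (ω : {ω // ¬pD ω}), ((ρU (φ i h) ω) : T × Fin m) = θ h ω.1 := by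
    intro h ω
    rw [← hκ h ω, ← MonoidHom.comp_apply, hρU]
  refine ⟨(Perm.subtypeCongrHom pD).comp (ρD.prod ρU), ?_, ?_⟩
  · refine MonoidHom.ext fun h => Equiv.ext fun ω => ?_
    rw [MonoidHom.comp_apply, MonoidHom.comp_apply, MonoidHom.prod_apply,
      Perm.subtypeCongrHom_apply]
    by_cases hω : pD ω
    · rw [Perm.subtypeCongr.left_apply _ _ hω, hρD]
      refine Prod.ext (Subtype.ext ?_) ?_
      · rw [(hactD _ _).1, (hθ h ω).1, of_apply_eq_base]
      · rw [(hactD _ _).2, (hθ h ω).2]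
    · rw [Perm.subtypeCongr.right_apply _ _ hω, hρU']
  · intro g ω hω
    have hω' : pD ω := (hpD ω).mpr hω
    rw [MonoidHom.comp_apply, MonoidHom.prod_apply, Perm.subtypeCongrHom_apply,
      Perm.subtypeCongr.left_apply _ _ hω', hρD]
    exact hactD g ⟨ω, hω'⟩

/-- **Finite completion of the truncated regular action.**  Let `T ⊆ Γ = ∗_H G i` be a finite
set stable under the base group (`φ i` injective, `G i` finite, `ι` finite).  Then for
`m = ∏ |G i|` there is a homomorphism `F : Γ →* Perm (T × Fin m)` which is honest left
multiplication by `of i g` at every point `(x, r)` all of whose `G i`-translates stay in `T`.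
[cite: CohenCGT1989, Ch. 1 proof of Prop. 33] -/
theorem exists_perm_hom_of_base_stable [Fintype ι] [∀ i, Finite (G i)]
    (hφ : ∀ j, Injective (φ j)) (T : Set (PushoutI φ)) [Finite T]
    (hbase : ∀ (h : H) (x : PushoutI φ), x ∈ T → base φ h * x ∈ T) :
    ∃ (m : ℕ), 0 < m ∧ ∃ F : PushoutI φ →* Perm (T × Fin m),
      ∀ (i : ι) (g : G i) (ω : T × Fin m), (∀ g' : G i, of i g' * (ω.1 : PushoutI φ) ∈ T) →
        ((F (of i g) ω).1 : PushoutI φ) = of i g * (ω.1 : PushoutI φ) ∧ (F (of i g) ω).2 = ω.2 := by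
  classical
  let m : ℕ := ∏ i, Nat.card (G i)
  have hm : 0 < m := Finset.prod_pos fun i _ => Nat.card_pos
  have hdvd : ∀ i, Nat.card (G i) ∣ m := fun i => Finset.dvd_prod_of_mem _ (Finset.mem_univ i)
  -- the honest action of `H` on `Ω = T × Fin m`
  let θfun : H → T × Fin m → T × Fin m := fun h ω =>
    (⟨base φ h * (ω.1 : PushoutI φ), hbase h _ ω.1.2⟩, ω.2)
  have hθfun : ∀ (h : H) (ω : T × Fin m),
      ((θfun h ω).1 : PushoutI φ) = base φ h * (ω.1 : PushoutI φ) ∧ (θfun h ω).2 = ω.2 :=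
    fun _ _ => ⟨rfl, rfl⟩
  have θfun_mul : ∀ (h h' : H) (ω : T × Fin m), θfun (h * h') ω = θfun h (θfun h' ω) := by
    intro h h' ω
    refine Prod.ext (Subtype.ext ?_) ?_
    · rw [(hθfun (h * h') ω).1, (hθfun h (θfun h' ω)).1, (hθfun h' ω).1, map_mul, mul_assoc]
    · rw [(hθfun (h * h') ω).2, (hθfun h (θfun h' ω)).2, (hθfun h' ω).2]
  have θfun_one : ∀ ω : T × Fin m, θfun 1 ω = ω := by
    intro ω
    refine Prod.ext (Subtype.ext ?_) ?_
    · rw [(hθfun 1 ω).1, map_one, one_mul]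
    · rw [(hθfun 1 ω).2]
  let θ : H →* Perm (T × Fin m) :=
    { toFun := fun h =>
        { toFun := θfun h
          invFun := θfun h⁻¹
          left_inv := fun ω => by rw [← θfun_mul, inv_mul_cancel, θfun_one]
          right_inv := fun ω => by rw [← θfun_mul, mul_inv_cancel, θfun_one] }
      map_one' := by ext ω : 1; exact θfun_one ω
      map_mul' := fun h h' => by ext ω : 1; exact θfun_mul h h' ω }
  have hθ : ∀ (h : H) (ω : T × Fin m),
      ((θ h ω).1 : PushoutI φ) = base φ h * (ω.1 : PushoutI φ) ∧ (θ h ω).2 = ω.2 :=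
    fun h ω => hθfun h ω
  have key := fun i : ι => exists_perm_hom_factor (φ := φ) i hφ (hdvd i) θ hθ
  choose ρ hρθ hρD using key
  refine ⟨m, hm, PushoutI.lift ρ θ hρθ, fun i g ω hω => ?_⟩
  rw [PushoutI.lift_of]
  exact hρD i g ω hω

/-- **Amalgamated free products of finite groups are residually finite.**  For a finite index type
`ι`, finite groups `G i`, a finite group `H` and injective `φ i : H →* G i`, the amalgam
`Monoid.PushoutI φ = ∗_H G i` is residually finite.
[cite: CohenCGT1989, Ch. 1 Props. 22, 33 and Exercise 27] -/
theorem pushoutI_residuallyFinite [Finite ι] [∀ i, Finite (G i)] [Finite H]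
    (hφ : ∀ i, Injective (φ i)) : Group.ResiduallyFinite (PushoutI φ) := by
  classical
  rcases isEmpty_or_nonempty ι with hι | hι
  · -- `Γ = base(H)` is finite
    haveI : Finite (PushoutI φ) := Finite.of_surjective _ base_surjective_of_isEmpty
    infer_instance
  haveI : Fintype ι := Fintype.ofFinite ι
  refine Group.residuallyFinite_of_forall_exists_finite_monoidHom fun γ hγ => ?_
  obtain ⟨L, hL⟩ := exists_list_prod_eq γ
  -- the truncation `T`: all `of i g · (suffix product)`
  let T : Set (PushoutI φ) := {x | ∃ (i : ι) (g : G i) (L' : List (Σ i, G i)),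
    L' <:+ L ∧ x = of i g * (L'.map fun y => of (φ := φ) y.1 y.2).prod}
  have hTmem : ∀ {L' : List (Σ i, G i)}, L' <:+ L → ∀ (i : ι) (g : G i),
      of i g * (L'.map fun y => of (φ := φ) y.1 y.2).prod ∈ T :=
    fun hL' i g => ⟨i, g, _, hL', rfl⟩
  have hTfin : T.Finite := by
    refine Set.Finite.subset (Set.Finite.biUnion (List.finite_toSet L.tails) fun L' _ =>
      Set.finite_range fun y : (Σ i, G i) =>
        of (φ := φ) y.1 y.2 * (L'.map fun y => of (φ := φ) y.1 y.2).prod) ?_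
    rintro x ⟨i, g, L', hL', rfl⟩
    exact Set.mem_iUnion₂.mpr ⟨L', (List.mem_tails L' L).mpr hL', ⟨⟨i, g⟩, rfl⟩⟩
  haveI : Finite T := hTfin.to_subtype
  have hbase : ∀ (h : H) (x : PushoutI φ), x ∈ T → base φ h * x ∈ T := by
    rintro h x ⟨i, g, L', hL', rfl⟩
    refine ⟨i, φ i h * g, L', hL', ?_⟩
    rw [map_mul, of_apply_eq_base, mul_assoc]
  obtain ⟨m, hm, F, hF⟩ := exists_perm_hom_of_base_stable (φ := φ) hφ T hbase
  have h1T : (1 : PushoutI φ) ∈ T := by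
    obtain ⟨i⟩ := hι
    have h := hTmem List.nil_suffix i 1
    simpa using h
  let ω₀ : T × Fin m := (⟨1, h1T⟩, ⟨0, hm⟩)
  -- along the suffixes of `L`, `F` acts honestly on `ω₀`
  have path : ∀ L' : List (Σ i, G i), L' <:+ L →
      ((F (L'.map fun y => of (φ := φ) y.1 y.2).prod ω₀).1 : PushoutI φ) =
          (L'.map fun y => of (φ := φ) y.1 y.2).prod ∧
        (F (L'.map fun y => of (φ := φ) y.1 y.2).prod ω₀).2 = ⟨0, hm⟩ := by
    intro L'
    induction L' with
    | nil =>
      intro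
      rw [List.map_nil, List.prod_nil, map_one, Perm.one_apply]
      exact ⟨rfl, rfl⟩
    | cons x L'' ih =>
      intro hsuf
      have hsuf' : L'' <:+ L := List.IsSuffix.trans (List.suffix_cons x L'') hsuf
      obtain ⟨ih1, ih2⟩ := ih hsuf'
      have hmem : ∀ g' : G x.1, of x.1 g' *
          ((F (L''.map fun y => of (φ := φ) y.1 y.2).prod ω₀).1 : PushoutI φ) ∈ T := by
        intro g'; rw [ih1]; exact hTmem hsuf' x.1 g'
      rw [List.map_cons, List.prod_cons, map_mul, Perm.mul_apply]
      obtain ⟨e1, e2⟩ := hF x.1 x.2 _ hmem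
      rw [e1, e2, ih1, ih2]
      exact ⟨rfl, rfl⟩
  refine ⟨Perm (T × Fin m), inferInstance, inferInstance, F, fun hF1 => hγ ?_⟩
  have hγ1 := (path L (List.suffix_refl L)).1
  rw [← hL, hF1, Perm.one_apply] at hγ1
  exact hγ1.symm

end Literature.GroupTheory.CombinatorialGroupTheory
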